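import Summits.RiemannHypothesis.RiemannHypothesis.Theorems.PfPersistenceF1AnalyticTwinContinuum

/-!
# PF persistence, fake seat 1 — the Gaussian concentration test: no heavy atoms (FAKES §1.12)

Unit `pub-rhpf-fake-1` of the `pub-rhpf` cell (mechanism / rigidity campaign; **no RH claims**).

FAKES §1.12 (THEOREM F1-X, THEOREM-informal, unconditional in the g-system): if `μ` is a spectral
measure of a Weil-positive ζ-dressed g-prime system `P` (`IsSpectralMeasure (beurlingDatum g m) μ`), then
pairing the explicit formula with the Gaussian-decay test `k(x) = (2s/√(2π)) e^{-s²x²/2} cos(tx)` (whose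
transform is `e^{-(u-t)²/2s²} + e^{-(u+t)²/2s²}`) gives, for every resolution `s > 0`,
`μ([t-s, t+s]) ≤ (e^{1/2} s/√(2π) + o(1)) log|t| + O_s(1)`: the archimedean term contributes
`(s/√(2π)) log|t|`, the polar term and the prime sum of `P` contribute `t`-independent constants of size
`≍ e^{1/(8s²)}` (the prime sum by the translate-pair growth of `PfPersistenceF1TranslateBound`).  Hence an
honest — indeed any — spectral measure has NO HEAVY ATOMS: `μ {t} = o(log|t|)`.  With the kernel
asymptotics of FAKES §1.11 (THEOREM F1-W: the de Branges canonical twins of `μ_Z` below depth `U = e^L`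
have atoms of mass `(1+o(1)) log(t/2π)/L`, under RH) this shows that NO canonical twin, evenised twin,
segment or finite convex combination of them is a spectral measure of any g-prime system (COROLLARY
F1-X.1).

Typed here: `HeavyAtoms μ` (atoms of mass `≥ c log t` along heights `t → ∞`); the typed form
`SpectralNoHeavyAtoms` of THEOREM F1-X (statement only: the explicit-formula side is not in the tree);
the typed premise `SomeAnalyticTwinHasHeavyAtoms` of COROLLARY F1-X.1 (statement only); and the PROVED
bookkeeping: heavy atoms exclude membership in every `BLExt U`, heavy atoms propagate along the segment to
`μZ` (parameter `θ ∈ (0, 1]`), and the two statements together yield, below every depth, a continuum's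
worth of directions of analytic twins none of which is honest at ANY depth.  Nothing about `ζ` is asserted.
-/

set_option linter.dupNamespace false

noncomputable section

open MeasureTheory Set Complex
open scoped ENNReal

namespace Summit.RiemannHypothesis.RiemannHypothesis.Theorems.PfPersistence.Fake1.GaussTest

open Summit.RiemannHypothesis.RiemannHypothesis.Theorems.PfPersistenceBarrier
open Summit.RiemannHypothesis.RiemannHypothesis.Theorems.PfPersistence.Fake1
open Summit.RiemannHypothesis.RiemannHypothesis.Theorems.PfPersistence.Fake1.BLExt
open Summit.RiemannHypothesis.RiemannHypothesis.Theorems.PfPersistence.Fake1.AnalyticTwin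

/-! ## Heavy atoms -/

/-- `μ` has HEAVY ATOMS: for some `c > 0` there are arbitrarily large heights `t` carrying an atom of
mass at least `c · log t`. (The de Branges canonical twins of `μ_Z` have this with `c` close to `1/L`,
FAKES §1.11; `μ_Z` itself does not: multiplicities are `o(log t)`.) [folklore] -/
def HeavyAtoms (μ : Measure ℝ) : Prop :=
  ∃ c : ℝ, 0 < c ∧ ∀ T : ℝ, ∃ t : ℝ, T ≤ t ∧ c * Real.log t ≤ (μ {t}).toReal

/-- **Typed THEOREM F1-X (atomic form)** — statement only (THEOREM-informal, FAKES §1.12; its proof is the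
explicit formula paired with a Gaussian test, not available in the tree): a spectral measure of a
ζ-dressed g-prime system has no heavy atoms. (A `Prop`; not a Literature fact.) -/
def SpectralNoHeavyAtoms : Prop :=
  ∀ (g : ℕ → ℝ) (m : ℕ → ℕ), (∀ i, 1 < g i) → Function.Injective g →
    ∀ μ : Measure ℝ, IsSpectralMeasure (beurlingDatum g m) μ → ¬ HeavyAtoms μ

/-- **Typed premise of COROLLARY F1-X.1** — statement only (THEOREM-informal under RH, FAKES §1.11–1.12:
an even de Branges canonical twin below depth `U` is an analytic twin of `μZ` with atoms of mass
`(1+o(1)) log(t/2π)/log U`): below every depth some analytic twin of `μZ` has heavy atoms. -/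
def SomeAnalyticTwinHasHeavyAtoms : Prop :=
  ∀ U : ℝ, 1 < U → ∀ μZ : Measure ℝ, IsSpectralMeasure zetaC μZ →
    ∃ μ ∈ AnalyticBLExt U μZ, HeavyAtoms μ

/-! ## Bookkeeping (PROVED) -/

/-- A heavy atom at a height `t > 1` has finite (indeed positive real) mass. [folklore] -/
theorem HeavyAtoms.toReal_pos {μ : Measure ℝ} {c t : ℝ} (hc : 0 < c) (ht : 1 < t)
    (h : c * Real.log t ≤ (μ {t}).toReal) : 0 < (μ {t}).toReal :=
  lt_of_lt_of_le (mul_pos hc (Real.log_pos ht)) h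

/-- Heavy atoms exclude honesty at every depth, granting THEOREM F1-X. [folklore] -/
theorem not_mem_blExt_of_heavyAtoms (hX : SpectralNoHeavyAtoms) {μ : Measure ℝ} (hμ : HeavyAtoms μ)
    (U : ℝ) : μ ∉ BLExt U := by
  rintro ⟨g, m, hg, hinj, -, hsp⟩
  exact hX g m hg hinj μ hsp hμ

/-- Scaling a measure by `θ > 0` keeps heavy atoms (constant `θ c`). [folklore] -/
theorem HeavyAtoms.smul {μ : Measure ℝ} (h : HeavyAtoms μ) {θ : ℝ} (hθ : 0 < θ) :
    HeavyAtoms (ENNReal.ofReal θ • μ) := by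
  obtain ⟨c, hc, hT⟩ := h
  refine ⟨θ * c, mul_pos hθ hc, fun T => ?_⟩
  obtain ⟨t, hTt, ht⟩ := hT T
  refine ⟨t, hTt, ?_⟩
  rw [Measure.smul_apply, smul_eq_mul, ENNReal.toReal_mul, ENNReal.toReal_ofReal hθ.le, mul_assoc]
  exact mul_le_mul_of_nonneg_left ht hθ.le

/-- Adding a measure with finite singletons keeps heavy atoms. [folklore] -/
theorem HeavyAtoms.add_right {μ ν : Measure ℝ} (h : HeavyAtoms μ) (hν : ∀ t : ℝ, ν {t} ≠ ⊤) :
    HeavyAtoms (μ + ν) := by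
  obtain ⟨c, hc, hT⟩ := h
  refine ⟨c, hc, fun T => ?_⟩
  obtain ⟨t, hTt, ht⟩ := hT (max T 2)
  have ht1 : 1 < t := by linarith [le_max_right T 2]
  have hfin : μ {t} ≠ ⊤ := by
    intro htop
    have := HeavyAtoms.toReal_pos (μ := μ) hc ht1 ht
    simp [htop] at this
  refine ⟨t, (le_max_left T 2).trans hTt, ?_⟩
  rw [Measure.add_apply, ENNReal.toReal_add hfin (hν t)]
  exact ht.trans (le_add_of_nonneg_right ENNReal.toReal_nonneg)

/-- Singletons are finite for an even tempered measure. [folklore] -/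
theorem IsEvenTempered.singleton_ne_top {μ : Measure ℝ} (hμ : IsEvenTempered μ) (t : ℝ) : μ {t} ≠ ⊤ := by
  obtain ⟨-, C, N, hgr⟩ := hμ
  have hsub : ({t} : Set ℝ) ⊆ Icc (-|t|) |t| := by
    intro x hx
    rw [mem_singleton_iff.1 hx]
    exact ⟨neg_abs_le t, le_abs_self t⟩
  exact ((measure_mono hsub).trans_lt (lt_top_iff_ne_top.2 (hgr |t| (abs_nonneg t)).1)).ne

/-- **Heavy atoms propagate along the segment** `θ ↦ θ•μ + (1-θ)•μZ` for `θ ∈ (0, 1]` when `μZ` is even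
tempered. [folklore] -/
theorem heavyAtoms_segment {μZ μ : Measure ℝ} (hZ : IsEvenTempered μZ) (h : HeavyAtoms μ) {θ : ℝ}
    (hθ : 0 < θ) : HeavyAtoms (AnalyticTwin.segment μZ μ θ) := by
  unfold AnalyticTwin.segment
  refine (h.smul hθ).add_right fun t => ?_
  rw [Measure.smul_apply, smul_eq_mul]
  exact ENNReal.mul_ne_top ENNReal.ofReal_ne_top (IsEvenTempered.singleton_ne_top hZ t)

/-- **Typed COROLLARY F1-X.1 (bookkeeping form)**: granting THEOREM F1-X and its premise, below every
depth `U > 1` there is an analytic twin `μ ≠ μZ` of `μZ` such that NO point `θ•μ + (1-θ)•μZ`, `θ ∈ (0,1]`,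
of the segment from `μZ` to `μ` is honest at ANY depth `U'` — although all of them are analytic twins
below depth `U` (`segment_mem_analyticBLExt`). [folklore] -/
theorem segment_not_mem_blExt (hX : SpectralNoHeavyAtoms) (hH : SomeAnalyticTwinHasHeavyAtoms)
    {U : ℝ} (hU : 1 < U) {μZ : Measure ℝ} (hZ : IsSpectralMeasure zetaC μZ) :
    ∃ μ ∈ AnalyticBLExt U μZ, ∀ θ : ℝ, 0 < θ → θ ≤ 1 →
      AnalyticTwin.segment μZ μ θ ∈ AnalyticBLExt U μZ ∧
        ∀ U' : ℝ, AnalyticTwin.segment μZ μ θ ∉ BLExt U' := by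
  obtain ⟨μ, hμ, hheavy⟩ := hH U hU μZ hZ
  have hZmem : μZ ∈ AnalyticBLExt U μZ := self_mem_analyticBLExt hZ U
  refine ⟨μ, hμ, fun θ hθ0 hθ1 => ⟨segment_mem_analyticBLExt hZmem hμ hθ0.le hθ1, fun U' => ?_⟩⟩
  exact not_mem_blExt_of_heavyAtoms hX (heavyAtoms_segment hZmem.1 hheavy hθ0) U'

/-- In particular (θ = 1): granting F1-X and its premise, below every depth some analytic twin of `μZ`
is dishonest at every depth — the typed shape of 'no canonical twin is honest'. [folklore] -/
theorem exists_analyticTwin_not_mem_blExt (hX : SpectralNoHeavyAtoms) (hH : SomeAnalyticTwinHasHeavyAtoms)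
    {U : ℝ} (hU : 1 < U) {μZ : Measure ℝ} (hZ : IsSpectralMeasure zetaC μZ) :
    ∃ μ ∈ AnalyticBLExt U μZ, ∀ U' : ℝ, μ ∉ BLExt U' := by
  obtain ⟨μ, hμ, hheavy⟩ := hH U hU μZ hZ
  exact ⟨μ, hμ, fun U' => not_mem_blExt_of_heavyAtoms hX hheavy U'⟩

/-- `μZ` itself has no heavy atoms, granting F1-X (it is the spectral measure of the primes, which are
honest below every depth: `μZ ∈ BLExt U`). [folklore] -/
theorem not_heavyAtoms_of_mem_blExt (hX : SpectralNoHeavyAtoms) {U : ℝ} {μZ : Measure ℝ}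
    (hZ : μZ ∈ BLExt U) : ¬ HeavyAtoms μZ :=
  fun h => not_mem_blExt_of_heavyAtoms hX h U hZ

end Summit.RiemannHypothesis.RiemannHypothesis.Theorems.PfPersistence.Fake1.GaussTest
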